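import Literature.NumberTheory.NumberFields.QuadraticUnramifiedAtUnitPlace   -- ★ (Q4-inert) `isSquare_inv_mul_of_valued_sub_lt` (Hensel) (+ ★ (Q4-ram), (Q3), (QM), (QP), (Q2))
import HarnessLib

/-!
# THE INTEGRAL BASIS `(1, θ)` OF `E_w` OVER `𝒪_v` FOR `θ² = ι_w d`: `𝒪[E_w] = ι_w 𝒪_v ⊕ ι_w 𝒪_v·θ` WHEN `d` IS A UNIFORMIZER (RAMIFIED) OR A NON-SQUARE UNIT AT `v ∤ 2` (INERT)
# («K₁ AS A COMPLETION», (Q5): `𝒪_{K₁}` and the valuation of `K₁ = F_v(√d) = E_w` in the coordinates of ★ (Q1)∕(Q2))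

Topic `NumberTheory/NumberFields`; namespace `Literature.NumberTheory.NumberFields`.  THEOREMS ONLY (no definition, no instance, no notation, no named fact,
no `sorry`).  Cell `pub/hodgecm-mathlib` (D-0151), crux H413 = `stmt-HodgeConjecture-24833` (`--supports`), infrastructure organ «LQC — K₁ AS A COMPLETION» (A-80 (2)),
consumer P-2 row (R2²) (F0P2-p06 (g10) 18:40:20Z: «the unit index of `L_w × K₁` will want `k_{K₁}` ∕ `𝒪_{K₁}` via the `AdjoinRoot` iso»).  HONEST LABEL: HC_CM is proved only
modulo the printed citations (hLiu418, h413) until rung 0 closes; this file is unconditional local algebra.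

WHAT THIS FILE DOES.  `E ∕ F` number fields, `v` a finite place of `F`, `w ∣ v`, `ι = ι_w = toPlace v w : F_v →+* E_w`, `θ ∈ E_w`.
* §1 RAMIFIED (`e(w|v) = 2`, `|θ|_w = |ϖ_w|`, e.g. `θ² = ι d` with `|d|_v = |ϖ_v|`, `valued_eq_exp_neg_one_of_sq_eq_toPlace`): **`valued_toPlace_add_toPlace_mul_of_ramified`**
  `|ι p + ι q·θ|_w = max (|p|_v², |q|_v²·|ϖ_w|)` (the two terms have valuations of distinct parity) and **`toPlace_add_toPlace_mul_mem_integer_iff_of_ramified`**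
  `ι p + ι q·θ ∈ 𝒪[E_w] ⟺ |p|_v ≤ 1 ∧ |q|_v ≤ 1` — the Eisenstein basis `𝒪[E_w] = 𝒪_v ⊕ 𝒪_v ϖ_w` (generic `E ∕ F` twin of ★ `RamifiedPlaceEisensteinBasis`, typed there for CM `L ∕ L⁺`).
* §2 INERT (`e(w|v) = 1` — `ramificationIdx'_eq_one_of_isUnramifiedIn` from the `hv` of ★ (Q4-inert) —, `|2|_v = 1`, `θ² = ι d` with `|d|_v = 1`, `d ∉ (F_v)²`):
  `valued_lt_one_of_valued_toPlace_add_toPlace_mul_lt_one` (for `|p|, |q| ≤ 1`: `|ι p + ι q θ| < 1 ⇒ |p|, |q| < 1` — else `θ ≡ ι c (mod 𝔪_w)` with `c ∈ 𝒪_v^×`, so `|d − c²|_v < 1` and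
  `d` would be a square by Hensel, ★ `isSquare_inv_mul_of_valued_sub_lt`), **`valued_toPlace_add_toPlace_mul_of_unit`** `|ι p + ι q·θ|_w = max (|p|_v, |q|_v)` and
  **`toPlace_add_toPlace_mul_mem_integer_iff_of_unit`** `ι p + ι q·θ ∈ 𝒪[E_w] ⟺ |p|_v ≤ 1 ∧ |q|_v ≤ 1` — `𝒪[E_w] = 𝒪_v ⊕ 𝒪_v θ` (unit discriminant `4d`).
* §3 COORDINATES: for the quadratic field `E ∋ δ` (`σ δ = −δ ≠ 0`, `δ² = m`), `d` a local non-square with `d⁻¹ m ∈ (F_v^×)²` and ANY `θ` with `θ² = ι d`: every `z ∈ E_w` is uniquely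
  `ι p + ι q·θ` (`existsUnique_eq_toPlace_add_toPlace_mul_of_sq_eq`, from ★ (Q2) by `θ = ± δ_w ∕ ι s`); with §1∕§2 this is `𝒪_{K₁} = 𝒪_v ⊕ 𝒪_v θ` for `K₁ = F_v(√d) = E_w` read through
  the isomorphism of ★ (Q1) `exists_ringEquiv_adjoinRoot_X_sq_sub_C` (`θ = e(root)`).

## References
* [SerreLocalFields1979] J.-P. Serre, *Local Fields*, GTM 67 (1979): Ch. I §6 Prop. 17–18 (integral bases of totally ramified ∕ unramified extensions: `𝒪_L = 𝒪_K[π]`, `𝒪_L = 𝒪_K[θ̄ lift]`).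
* [Neukirch1999] J. Neukirch, *Algebraic Number Theory*, Grundlehren 322 (1999): Ch. II §6–§7 (henselian∕unramified and tamely ramified extensions), Ch. II (5.7).
* [CasselsFrohlich1967] J. W. S. Cassels, A. Fröhlich (eds.), *Algebraic Number Theory* (1967): Ch. I §5–§6 (Fröhlich: ramification, totally ramified extensions, Eisenstein).
-/

set_option autoImplicit false

noncomputable section

open NumberField IsDedekindDomain Polynomial
open scoped ValuativeRel
open Literature.NumberTheory.Automorphic Literature.NumberTheory.Automorphic.UnitaryGroup

namespace Literature.NumberTheory.NumberFields

/-- `z ∈ 𝒪[K] ⟺ |z| ≤ 1` for the `Valued` valuation of a field carrying a compatible `ValuativeRel` (the tree's ★ `v_le_one_iff_mem_integer`, restated to keep imports light).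
[cite: SerreLocalFields1979, Ch. II §1] -/
theorem mem_integer_iff_valued_le_one {K : Type} [Field K] [Valued K (WithZero (Multiplicative ℤ))] [ValuativeRel K]
    [(Valued.v : Valuation K (WithZero (Multiplicative ℤ))).Compatible] (z : K) : z ∈ 𝒪[K] ↔ Valued.v z ≤ 1 := by
  rw [Valuation.mem_integer_iff, ← Valuation.vle_one_iff (ValuativeRel.valuation K), Valuation.vle_one_iff (Valued.v : Valuation K (WithZero (Multiplicative ℤ)))]

variable {F : Type} (E : Type) [Field F] [NumberField F] [Field E] [NumberField E] [Algebra F E]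

/-! ## §1 RAMIFIED: `θ` a uniformizer of `E_w`, `e(w|v) = 2` -/

section Ramified

variable (v : HeightOneSpectrum (𝓞 F)) (w : PlacesOver E v) (he : v.asIdeal.ramificationIdx' w.1.asIdeal = 2)
include he

/-- At a place with `e(w|v) = 2`: `|ι_w y|_w = |y|_v ²` (★ `valued_toPlace`). [cite: SerreLocalFields1979, Ch. I §4] -/
theorem valued_toPlace_of_ramificationIdx'_eq_two (y : v.adicCompletion F) : Valued.v (toPlace v w y) = Valued.v y ^ 2 := by
  rw [valued_toPlace, he]

/-- **A square root of a uniformizer of `F_v` is a uniformizer of `E_w`** (`e(w|v) = 2`): `θ² = ι_w d`, `|d|_v = |ϖ_v| = exp (−1)` ⇒ `|θ|_w = exp (−1) = |ϖ_w|`.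
[cite: SerreLocalFields1979, Ch. I §6 Prop. 17] [cite: CasselsFrohlich1967, Ch. I §6] -/
theorem valued_eq_exp_neg_one_of_sq_eq_toPlace {θ : w.1.adicCompletion E} {d : v.adicCompletion F} (hθ : θ ^ 2 = toPlace v w d)
    (hd : Valued.v d = WithZero.exp (-1 : ℤ)) : Valued.v θ = WithZero.exp (-1 : ℤ) := by
  have h := congrArg Valued.v hθ
  rw [map_pow, valued_toPlace_of_ramificationIdx'_eq_two E v w he, hd, ← WithZero.exp_nsmul] at h
  have hθ0 : Valued.v θ ≠ 0 := by
    intro h0; rw [h0, zero_pow two_ne_zero] at h; exact WithZero.coe_ne_zero h.symm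
  rw [← WithZero.exp_log hθ0, ← WithZero.exp_nsmul, WithZero.exp_inj] at h
  rw [← WithZero.exp_log hθ0, WithZero.exp_inj]
  simp only [nsmul_eq_mul] at h
  push_cast at h
  omega

/-- **THE VALUATION IN THE EISENSTEIN COORDINATES** (`e(w|v) = 2`, `|θ|_w = |ϖ_w|`): `|ι p + ι q·θ|_w = max (|p|_v ², |q|_v ²·exp(−1))` — `|ι p|_w ∈ exp(2ℤ)` and `|ι q θ|_w ∈ exp(2ℤ − 1)`
never cancel. [cite: SerreLocalFields1979, Ch. I §6 Prop. 17–18] [cite: CasselsFrohlich1967, Ch. I §6] -/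
theorem valued_toPlace_add_toPlace_mul_of_ramified {θ : w.1.adicCompletion E} (hθ : Valued.v θ = WithZero.exp (-1 : ℤ)) (p q : v.adicCompletion F) :
    Valued.v (toPlace v w p + toPlace v w q * θ) = max (Valued.v p ^ 2) (Valued.v q ^ 2 * WithZero.exp (-1 : ℤ)) := by
  have hιp : Valued.v (toPlace v w p) = Valued.v p ^ 2 := valued_toPlace_of_ramificationIdx'_eq_two E v w he p
  have hιq : Valued.v (toPlace v w q * θ) = Valued.v q ^ 2 * WithZero.exp (-1 : ℤ) := by
    rw [map_mul, valued_toPlace_of_ramificationIdx'_eq_two E v w he q, hθ]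
  by_cases hp : p = 0
  · rw [hp, map_zero, zero_add, hιq, map_zero, zero_pow two_ne_zero, max_eq_right zero_le]
  by_cases hq : q = 0
  · rw [hq, map_zero, zero_mul, add_zero, hιp, map_zero, zero_pow two_ne_zero, zero_mul, max_eq_left zero_le]
  rw [← hιp, ← hιq]
  refine Valued.v.map_add_of_distinct_val ?_
  rw [hιp, hιq]
  have hp0 : Valued.v p ≠ 0 := by simpa using hp
  have hq0 : Valued.v q ≠ 0 := by simpa using hq
  rw [← WithZero.exp_log hp0, ← WithZero.exp_log hq0, ← WithZero.exp_nsmul, ← WithZero.exp_nsmul, ← WithZero.exp_add,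
    WithZero.exp_inj.ne, nsmul_eq_mul, nsmul_eq_mul]
  push_cast
  omega

/-- **THE EISENSTEIN BASIS `𝒪[E_w] = ι 𝒪_v ⊕ ι 𝒪_v·ϖ_w`** (`e(w|v) = 2`, `|θ|_w = |ϖ_w|`): `ι p + ι q·θ ∈ 𝒪[E_w] ⟺ |p|_v ≤ 1 ∧ |q|_v ≤ 1`.
[cite: SerreLocalFields1979, Ch. I §6 Prop. 18] [cite: Neukirch1999, Ch. II §6] -/
theorem toPlace_add_toPlace_mul_mem_integer_iff_of_ramified {θ : w.1.adicCompletion E} (hθ : Valued.v θ = WithZero.exp (-1 : ℤ)) (p q : v.adicCompletion F) :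
    toPlace v w p + toPlace v w q * θ ∈ 𝒪[w.1.adicCompletion E] ↔ Valued.v p ≤ 1 ∧ Valued.v q ≤ 1 := by
  rw [mem_integer_iff_valued_le_one, valued_toPlace_add_toPlace_mul_of_ramified E v w he hθ, max_le_iff, pow_le_one_iff two_ne_zero,
    and_congr_right_iff]
  intro _
  by_cases hq : q = 0
  · simp [hq]
  have hq0 : Valued.v q ≠ 0 := by simpa using hq
  rw [← WithZero.exp_log hq0, ← WithZero.exp_nsmul, ← WithZero.exp_add, ← WithZero.exp_zero, WithZero.exp_le_exp, WithZero.exp_le_exp,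
    nsmul_eq_mul]
  push_cast
  omega

end Ramified

/-! ## §2 INERT: `θ² = ι d`, `d` a non-square unit, `|2|_v = 1`, `e(w|v) = 1` -/

section Inert

variable (v : HeightOneSpectrum (𝓞 F)) (w : PlacesOver E v)

/-- `hv ⇒ e(w|v) = 1`: an unramified `v` (Mathlib `Algebra.IsUnramifiedIn (𝓞 E) v.asIdeal`, the `hv` of ★ (Q4-inert)) has `v.asIdeal.ramificationIdx' w.asIdeal = 1` at every `w ∣ v`
(Mathlib `Algebra.IsUnramifiedIn.ramificationIdx_eq_one` + `Ideal.ramificationIdx'_eq_ramificationIdx`). [cite: Neukirch1999, Ch. II §8] -/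
theorem ramificationIdx'_eq_one_of_isUnramifiedIn (hv : Algebra.IsUnramifiedIn (𝓞 E) v.asIdeal) : v.asIdeal.ramificationIdx' w.1.asIdeal = 1 := by
  haveI := PlacesOver.liesOver w
  rw [Ideal.ramificationIdx'_eq_ramificationIdx v.asIdeal w.1.asIdeal v.ne_bot]
  exact hv.ramificationIdx_eq_one (PlacesOver.liesOver w)

variable (he : v.asIdeal.ramificationIdx' w.1.asIdeal = 1)
include he

/-- At a place with `e(w|v) = 1`: `|ι_w y|_w = |y|_v` (★ `valued_toPlace`). [cite: SerreLocalFields1979, Ch. I §4] -/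
theorem valued_toPlace_of_ramificationIdx'_eq_one (y : v.adicCompletion F) : Valued.v (toPlace v w y) = Valued.v y := by
  rw [valued_toPlace, he, pow_one]

/-- **KEY STEP (inert)**: `|2|_v = 1`, `θ² = ι d` with `d` a NON-SQUARE UNIT of `F_v`, `e(w|v) = 1`; if `|p|_v, |q|_v ≤ 1` and `|ι p + ι q·θ|_w < 1` then `|p|_v < 1` and `|q|_v < 1`
(otherwise `|q| = 1`, `θ ≡ −ι(p∕q) (mod 𝔪_w)`, so `|d − (p∕q)²|_v < 1` and `d` is a square by Hensel, ★ `isSquare_inv_mul_of_valued_sub_lt`) — i.e. `θ̄ ∉ 𝓀_v`, `(1̄, θ̄)` free over `𝓀_v`.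
[cite: SerreLocalFields1979, Ch. I §6 Prop. 16–18] [cite: Neukirch1999, Ch. II (5.7)] -/
theorem valued_lt_one_of_valued_toPlace_add_toPlace_mul_lt_one (h2 : Valued.v (2 : v.adicCompletion F) = 1) {d : v.adicCompletion F}
    (hd : Valued.v d = 1) (hns : ¬ IsSquare d) {θ : w.1.adicCompletion E} (hθ : θ ^ 2 = toPlace v w d) {p q : v.adicCompletion F}
    (hp : Valued.v p ≤ 1) (hq : Valued.v q ≤ 1) (hlt : Valued.v (toPlace v w p + toPlace v w q * θ) < 1) :
    Valued.v p < 1 ∧ Valued.v q < 1 := by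
  have hι : ∀ y, Valued.v (toPlace v w y) = Valued.v y := valued_toPlace_of_ramificationIdx'_eq_one E v w he
  set ι := toPlace v w with hιdef
  -- `|θ| = 1`
  have hθ1 : Valued.v θ = 1 := by
    have h := congrArg Valued.v hθ
    rw [map_pow, hι, hd] at h
    have hθ0 : Valued.v θ ≠ 0 := by
      intro h0; rw [h0, zero_pow two_ne_zero] at h; exact zero_ne_one h
    rw [← WithZero.exp_log hθ0, ← WithZero.exp_nsmul, ← WithZero.exp_zero, WithZero.exp_inj] at h
    rw [← WithZero.exp_log hθ0, ← WithZero.exp_zero, WithZero.exp_inj]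
    simp only [nsmul_eq_mul] at h
    push_cast at h
    omega
  by_cases hq1 : Valued.v q < 1
  · refine ⟨?_, hq1⟩
    have hqt : Valued.v (-(ι q * θ)) < 1 := by rw [Valuation.map_neg, map_mul, hι, hθ1, mul_one]; exact hq1
    have h := Valued.v.map_add_lt hlt hqt
    rwa [add_neg_cancel_right, hι] at h
  exfalso
  have hq1' : Valued.v q = 1 := le_antisymm hq (not_lt.1 hq1)
  have hq0 : q ≠ 0 := by intro h0; rw [h0, map_zero] at hq1'; exact zero_ne_one hq1'
  have hιq0 : ι q ≠ 0 := (map_ne_zero ι).2 hq0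
  -- `c := -p/q ∈ 𝒪_v`, `θ ≡ ι c (mod 𝔪_w)`
  set c : v.adicCompletion F := -(p / q) with hc
  have h1 : θ - ι c = (ι q)⁻¹ * (ι p + ι q * θ) := by
    rw [hc, map_neg, map_div₀, sub_neg_eq_add, mul_add, ← mul_assoc, inv_mul_cancel₀ hιq0, one_mul, div_eq_mul_inv, mul_comm ((ι q)⁻¹)]
    ring
  have h1v : Valued.v (θ - ι c) < 1 := by
    rw [h1, map_mul, map_inv₀, hι, hq1', inv_one, one_mul]; exact hlt
  have hc1 : Valued.v c ≤ 1 := by rw [hc, Valuation.map_neg, map_div₀, hq1', div_one]; exact hp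
  have h2v : Valued.v (θ + ι c) ≤ 1 := Valued.v.map_add_le hθ1.le (by rw [hι]; exact hc1)
  -- `|d - c²|_v < 1`
  have h3 : Valued.v (d - c ^ 2) < 1 := by
    have heq : ι (d - c ^ 2) = (θ - ι c) * (θ + ι c) := by rw [map_sub, map_pow, ← hθ]; ring
    rw [← hι, heq, map_mul]
    calc Valued.v (θ - ι c) * Valued.v (θ + ι c) ≤ Valued.v (θ - ι c) * 1 := by gcongr
      _ = Valued.v (θ - ι c) := mul_one _
      _ < 1 := h1v
  -- hence `|c²| = 1`
  have hc2 : Valued.v (c ^ 2) = 1 := by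
    by_contra hne
    have hle : Valued.v (c ^ 2) ≤ 1 := by rw [map_pow]; exact pow_le_one₀ zero_le hc1
    have hlt' : Valued.v (-(c ^ 2)) < Valued.v d := by rw [Valuation.map_neg, hd]; exact lt_of_le_of_ne hle hne
    have : Valued.v (d - c ^ 2) = Valued.v d := by rw [sub_eq_add_neg, Valued.v.map_add_eq_of_lt_left hlt']
    rw [this, hd] at h3
    exact lt_irrefl _ h3
  have hc0 : c ^ 2 ≠ 0 := by intro h0; rw [h0, map_zero] at hc2; exact zero_ne_one hc2
  -- Hensel: `d ∕ c²` is a square, so `d` is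
  obtain ⟨t, ht⟩ := isSquare_inv_mul_of_valued_sub_lt v h2 hc0 (by rw [hc2]; exact h3)
  refine hns ⟨c * t, ?_⟩
  rw [← mul_inv_cancel_left₀ hc0 d, ht]
  ring

/-- **THE VALUATION IN THE UNRAMIFIED COORDINATES**: `|ι p + ι q·θ|_w = max (|p|_v, |q|_v)` (`|2|_v = 1`, `θ² = ι d`, `d` a non-square unit, `e(w|v) = 1`).
[cite: SerreLocalFields1979, Ch. I §6 Prop. 16] [cite: Neukirch1999, Ch. II §7] -/
theorem valued_toPlace_add_toPlace_mul_of_unit (h2 : Valued.v (2 : v.adicCompletion F) = 1) {d : v.adicCompletion F}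
    (hd : Valued.v d = 1) (hns : ¬ IsSquare d) {θ : w.1.adicCompletion E} (hθ : θ ^ 2 = toPlace v w d) (p q : v.adicCompletion F) :
    Valued.v (toPlace v w p + toPlace v w q * θ) = max (Valued.v p) (Valued.v q) := by
  have hι : ∀ y, Valued.v (toPlace v w y) = Valued.v y := valued_toPlace_of_ramificationIdx'_eq_one E v w he
  set ι := toPlace v w with hιdef
  have hθ1 : Valued.v θ ≤ 1 := by
    have h := congrArg Valued.v hθ
    rw [map_pow, hι, hd] at h
    exact (pow_le_one_iff two_ne_zero).1 h.le
  -- the normalised case: `|p'|, |q'| ≤ 1`, one of them `= 1` ⇒ `|ι p' + ι q' θ| = 1`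
  have key : ∀ p' q' : v.adicCompletion F, Valued.v p' ≤ 1 → Valued.v q' ≤ 1 → (Valued.v p' = 1 ∨ Valued.v q' = 1) →
      Valued.v (ι p' + ι q' * θ) = 1 := by
    intro p' q' hp' hq' h1
    have hle : Valued.v (ι p' + ι q' * θ) ≤ 1 :=
      Valued.v.map_add_le (by rw [hι]; exact hp') (by rw [map_mul, hι]; exact mul_le_one' hq' hθ1)
    refine le_antisymm hle (not_lt.1 fun hlt => ?_)
    have h := valued_lt_one_of_valued_toPlace_add_toPlace_mul_lt_one E v w he h2 hd hns hθ hp' hq' hlt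
    rcases h1 with h1 | h1
    · exact absurd h1 h.1.ne
    · exact absurd h1 h.2.ne
  rcases le_total (Valued.v q) (Valued.v p) with hqp | hpq
  · rw [max_eq_left hqp]
    by_cases hp : p = 0
    · have hq : q = 0 := by rw [hp, map_zero, le_zero_iff] at hqp; simpa using hqp
      rw [hp, hq, map_zero, map_zero, zero_mul, add_zero, map_zero]
    have hp0 : Valued.v p ≠ 0 := by simpa using hp
    have hfac : ι p + ι q * θ = ι p * (ι 1 + ι (q / p) * θ) := by
      rw [map_one, map_div₀, mul_add, mul_one, ← mul_assoc, mul_div_cancel₀ _ ((map_ne_zero ι).2 hp)]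
    rw [hfac, map_mul, hι, key 1 (q / p) (by rw [map_one]) (by rw [map_div₀]; exact div_le_one_of_le₀ hqp zero_le)
      (Or.inl (map_one _)), mul_one]
  · rw [max_eq_right hpq]
    by_cases hq : q = 0
    · have hp : p = 0 := by rw [hq, map_zero, le_zero_iff] at hpq; simpa using hpq
      rw [hp, hq, map_zero, map_zero, zero_mul, add_zero, map_zero]
    have hq0 : Valued.v q ≠ 0 := by simpa using hq
    have hfac : ι p + ι q * θ = ι q * (ι (p / q) + ι 1 * θ) := by
      rw [map_one, one_mul, map_div₀, mul_add, mul_div_cancel₀ _ ((map_ne_zero ι).2 hq)]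
    rw [hfac, map_mul, hι, key (p / q) 1 (by rw [map_div₀]; exact div_le_one_of_le₀ hpq zero_le) (by rw [map_one])
      (Or.inr (map_one _)), mul_one]

/-- **THE INTEGRAL BASIS `𝒪[E_w] = ι 𝒪_v ⊕ ι 𝒪_v·θ` AT AN INERT PLACE** (`|2|_v = 1`, `θ² = ι d`, `d` a non-square unit, `e(w|v) = 1`): `ι p + ι q·θ ∈ 𝒪[E_w] ⟺ |p|_v ≤ 1 ∧ |q|_v ≤ 1`.
[cite: SerreLocalFields1979, Ch. I §6 Prop. 16] [cite: Neukirch1999, Ch. II §7] -/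
theorem toPlace_add_toPlace_mul_mem_integer_iff_of_unit (h2 : Valued.v (2 : v.adicCompletion F) = 1) {d : v.adicCompletion F}
    (hd : Valued.v d = 1) (hns : ¬ IsSquare d) {θ : w.1.adicCompletion E} (hθ : θ ^ 2 = toPlace v w d) (p q : v.adicCompletion F) :
    toPlace v w p + toPlace v w q * θ ∈ 𝒪[w.1.adicCompletion E] ↔ Valued.v p ≤ 1 ∧ Valued.v q ≤ 1 := by
  rw [mem_integer_iff_valued_le_one, valued_toPlace_add_toPlace_mul_of_unit E v w he h2 hd hns hθ, max_le_iff]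

end Inert

/-! ## §3 COORDINATES with respect to any `θ` with `θ² = ι d` -/

section Coordinates

variable [Algebra.IsQuadraticExtension F E]

/-- **Every `z ∈ E_w` is uniquely `ι p + ι q·θ`** for ANY `θ ∈ E_w` with `θ² = ι_w d`, `d ∈ F_v` a non-square in the square class of `m` (`δ² = m`, `σ δ = −δ ≠ 0`; then `θ = ± δ_w ∕ ι s` with
`d⁻¹ m = s²`, and ★ (Q2) `existsUnique_eq_toPlace_add_toPlace_mul` transports). With §1∕§2: `𝒪[E_w] = {ι p + ι q θ : p, q ∈ 𝒪_v}` bijectively — `𝒪_{K₁} = 𝒪_v ⊕ 𝒪_v θ` for `K₁ = E_w`.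
[cite: Neukirch1999, Ch. II (8.2)–(8.3)] [cite: CasselsFrohlich1967, Ch. II §10] -/
theorem existsUnique_eq_toPlace_add_toPlace_mul_of_sq_eq (v : HeightOneSpectrum (𝓞 F)) (σ : E ≃ₐ[F] E) {δ : E} (hσδ : σ δ = -δ) (hδ : δ ≠ 0)
    {m : F} (hm : algebraMap F E m = δ ^ 2) {d : v.adicCompletion F} (hns : ¬ IsSquare d) (hdm : IsSquare (d⁻¹ * (m : v.adicCompletion F)))
    (w : PlacesOver E v) {θ : w.1.adicCompletion E} (hθ : θ ^ 2 = toPlace v w d) (z : w.1.adicCompletion E) :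
    ∃! pq : v.adicCompletion F × v.adicCompletion F, z = toPlace v w pq.1 + toPlace v w pq.2 * θ := by
  set ι := toPlace v w with hιdef
  have hd0 : d ≠ 0 := by rintro rfl; exact hns ⟨0, by simp⟩
  obtain ⟨s, hs⟩ := hdm
  have hm' : (m : v.adicCompletion F) = d * (s * s) := by rw [← hs, mul_inv_cancel_left₀ hd0]
  have hmv0 : (m : v.adicCompletion F) ≠ 0 := by
    intro h0
    have hm0 : m = 0 := (map_eq_zero_iff _ (algebraMap F (v.adicCompletion F)).injective).1 h0
    rw [hm0, map_zero] at hm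
    exact hδ (pow_eq_zero_iff two_ne_zero |>.1 hm.symm)
  have hs0 : s ≠ 0 := by rintro rfl; rw [mul_zero, mul_zero] at hm'; exact hmv0 hm'
  have hnsm : ¬ IsSquare (m : v.adicCompletion F) := by
    rintro ⟨t, ht⟩
    refine hns ⟨t * s⁻¹, ?_⟩
    have hd' : d = (m : v.adicCompletion F) * (s * s)⁻¹ := by rw [hm', mul_inv_cancel_right₀ (mul_ne_zero hs0 hs0)]
    rw [hd', ht]
    field_simp
  haveI := subsingleton_placesOver_of_not_isSquare E v σ hσδ hδ hm hnsm
  set δw : w.1.adicCompletion E := ((δ : E) : w.1.adicCompletion E) with hδw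
  have hδw2 : δw ^ 2 = ι (m : v.adicCompletion F) := algebraMap_adicCompletion_sq_eq_toPlace E v w hm
  -- `θ = δ_w · ι u` for `u = ± s⁻¹`
  obtain ⟨u, hu0, hθu⟩ : ∃ u : v.adicCompletion F, u ≠ 0 ∧ θ = δw * ι u := by
    have hsq : (θ * ι s) ^ 2 = δw ^ 2 := by rw [mul_pow, hθ, hδw2, hm', map_mul, map_mul, sq]
    rcases sq_eq_sq_iff_eq_or_eq_neg.1 hsq with h | h
    · refine ⟨s⁻¹, inv_ne_zero hs0, ?_⟩
      rw [map_inv₀, ← h, mul_inv_cancel_right₀ ((map_ne_zero ι).2 hs0)]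
    · refine ⟨-s⁻¹, neg_ne_zero.2 (inv_ne_zero hs0), ?_⟩
      rw [map_neg, map_inv₀, mul_neg, ← neg_mul, ← h, mul_inv_cancel_right₀ ((map_ne_zero ι).2 hs0)]
  have hιu0 : ι u ≠ 0 := (map_ne_zero ι).2 hu0
  have hconv : ∀ p q : v.adicCompletion F, ι p + ι q * θ = ι p + ι (q * u) * δw := by
    intro p q; rw [hθu, map_mul]; ring
  obtain ⟨⟨a, b⟩, hab, huniq⟩ := existsUnique_eq_toPlace_add_toPlace_mul E v σ hσδ hδ w z
  refine ⟨(a, b * u⁻¹), ?_, fun pq hpq => ?_⟩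
  · change z = ι a + ι (b * u⁻¹) * θ
    rw [hconv, inv_mul_cancel_right₀ hu0]; exact hab
  · have h := huniq (pq.1, pq.2 * u) (by change z = ι pq.1 + ι (pq.2 * u) * δw; rw [← hconv]; exact hpq)
    simp only [Prod.mk.injEq] at h
    obtain ⟨h1, h2⟩ := h
    exact Prod.ext h1 (by change pq.2 = b * u⁻¹; rw [← h2, mul_inv_cancel_right₀ hu0])

end Coordinates

end Literature.NumberTheory.NumberFields

end
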